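import Mathlib
import Summits.Ventures.PercRepro.PuncturedLYMMixT3Q1Table1

/-!
# PercRepro — (SP) FOR `3` PAIRWISE DISJOINT TRIPLES AND `1` PAIRWISE DISJOINT QUADRUPLES AT LEVEL `4`: THE TABLE IN `n` (2)
(p10, gen 41)

The instance `(k_3, k_4) = (3, 1)` on `n ≥ 13` points: the 67 integer numerators (degree ≤ 15), the common denominator `den` (degree 15), `Yc = #Y`, `Pc = #P`, the selectors by class and direction code, and the unnormalised weight `raw`. Row classes `(c31, c32, c41, c42, c43)` = (members of size `s` met in `v` points), `Σ_v c_{3v} ≤ 3`, `Σ_v c_{4v} ≤ 1`, `Σ v c ≤ 4`.  Nothing here asserts (SP).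
-/

namespace PercRepro.PuncturedLYM.Split.TypeLift.MixT3Q1

/-- The numerator selected by the class `(c31, c32, c41, c42, c43)` and the direction code `v`; `0` outside the table. -/
def sel (c31 c32 c41 c42 c43 v : ℕ) (n : ℚ) : ℚ :=
  if c31 = 0 ∧ c32 = 0 ∧ c41 = 0 ∧ c42 = 0 ∧ c43 = 0 then sel_00000 v n else
  if c31 = 0 ∧ c32 = 0 ∧ c41 = 0 ∧ c42 = 0 ∧ c43 = 1 then sel_00001 v n else
  if c31 = 0 ∧ c32 = 0 ∧ c41 = 0 ∧ c42 = 1 ∧ c43 = 0 then sel_00010 v n else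
  if c31 = 0 ∧ c32 = 0 ∧ c41 = 1 ∧ c42 = 0 ∧ c43 = 0 then sel_00100 v n else
  if c31 = 0 ∧ c32 = 1 ∧ c41 = 0 ∧ c42 = 0 ∧ c43 = 0 then sel_01000 v n else
  if c31 = 0 ∧ c32 = 1 ∧ c41 = 0 ∧ c42 = 1 ∧ c43 = 0 then sel_01010 v n else
  if c31 = 0 ∧ c32 = 1 ∧ c41 = 1 ∧ c42 = 0 ∧ c43 = 0 then sel_01100 v n else
  if c31 = 0 ∧ c32 = 2 ∧ c41 = 0 ∧ c42 = 0 ∧ c43 = 0 then sel_02000 v n else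
  if c31 = 1 ∧ c32 = 0 ∧ c41 = 0 ∧ c42 = 0 ∧ c43 = 0 then sel_10000 v n else
  if c31 = 1 ∧ c32 = 0 ∧ c41 = 0 ∧ c42 = 0 ∧ c43 = 1 then sel_10001 v n else
  if c31 = 1 ∧ c32 = 0 ∧ c41 = 0 ∧ c42 = 1 ∧ c43 = 0 then sel_10010 v n else
  if c31 = 1 ∧ c32 = 0 ∧ c41 = 1 ∧ c42 = 0 ∧ c43 = 0 then sel_10100 v n else
  if c31 = 1 ∧ c32 = 1 ∧ c41 = 0 ∧ c42 = 0 ∧ c43 = 0 then sel_11000 v n else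
  if c31 = 1 ∧ c32 = 1 ∧ c41 = 1 ∧ c42 = 0 ∧ c43 = 0 then sel_11100 v n else
  if c31 = 2 ∧ c32 = 0 ∧ c41 = 0 ∧ c42 = 0 ∧ c43 = 0 then sel_20000 v n else
  if c31 = 2 ∧ c32 = 0 ∧ c41 = 0 ∧ c42 = 1 ∧ c43 = 0 then sel_20010 v n else
  if c31 = 2 ∧ c32 = 0 ∧ c41 = 1 ∧ c42 = 0 ∧ c43 = 0 then sel_20100 v n else
  if c31 = 2 ∧ c32 = 1 ∧ c41 = 0 ∧ c42 = 0 ∧ c43 = 0 then sel_21000 v n else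
  if c31 = 3 ∧ c32 = 0 ∧ c41 = 0 ∧ c42 = 0 ∧ c43 = 0 then sel_30000 v n else
  if c31 = 3 ∧ c32 = 0 ∧ c41 = 1 ∧ c42 = 0 ∧ c43 = 0 then sel_30100 v n else
  0

/-- The unnormalised weight of a class towards a direction: column sums `1`, row sums `#Y / #P`. -/
def raw (n : ℚ) (c31 c32 c41 c42 c43 v : ℕ) : ℚ := sel c31 c32 c41 c42 c43 v n / (5 * den n)

end PercRepro.PuncturedLYM.Split.TypeLift.MixT3Q1
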